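import Mathlib
import Summits.SmoothPoincare4.SmoothPoincare4.Theorems.SoloInformedFusionOneDiscGroup
import Summits.SmoothPoincare4.SmoothPoincare4.Theorems.SoloInformedNashStipsiczGroup

/-!
# SoloInformed — the Nash–Stipsicz group is a fusion-number-one disc group

Solo programme `solo-SmoothPoincare4-informed` (session 7), calibration of the instance problem (Q_C).

The Nash–Stipsicz relator `r = x y x y x⁻¹ y⁻¹ x y⁻¹ x⁻¹ y⁻¹` of `π₁(S⁴ ∖ K²_{1,-1})`
(Nash–Stipsicz, arXiv:1103.5571, Prop. 4.2, case `p, q` odd) is, letter for letter,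
`x · w · y⁻¹ · w⁻¹` with the band word `w = y x y x⁻¹`; equivalently it is the conjugate
`x · (x⁻¹ w y w⁻¹)⁻¹ · x⁻¹` of the inverse of the disc relator `FusionOne.discRelator w`.
Hence `G_NS = ⟨x, y | r⟩` is (canonically isomorphic to) the fusion-number-one disc group
`FusionOne.DiscGroup w = ⟨x₁, x₂ | x₁ = w x₂ w⁻¹⟩`, and that disc group is not solvable
(by `NashStipsicz.not_isSolvable`, session 7).

Topological reading (not formalised): `π₁(S⁴ ∖ (D₁ ∪ D̄₂)) = Γ_{D₁} / ⟨⟨m_{D₂}⟩⟩`, so a one-relator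
presentation by the disc relator of `D₁` says the band meridian of `D₂` dies in `Γ_{D₁}`.
-/

namespace Summit.SmoothPoincare4.SmoothPoincare4.Theorems
namespace NashStipsicz

/-- The Nash–Stipsicz band word `w = y x y x⁻¹` (`x = of 0`, `y = of 1`). -/
def nsBandWord : FreeGroup (Fin 2) :=
  FreeGroup.of 1 * FreeGroup.of 0 * FreeGroup.of 1 * (FreeGroup.of 0)⁻¹

/-- `r = x · w · y⁻¹ · w⁻¹` with `w = y x y x⁻¹`. -/
theorem nsRelator_eq_bandWord_form :
    nsRelator = FreeGroup.of 0 * nsBandWord * (FreeGroup.of 1)⁻¹ * nsBandWord⁻¹ := by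
  simp only [nsRelator, nsBandWord, mul_inv_rev, inv_inv, mul_assoc]

/-- `r = x · (discRelator w)⁻¹ · x⁻¹`. -/
theorem nsRelator_eq_conj_inv_discRelator :
    nsRelator = FreeGroup.of 0 * (FusionOne.discRelator nsBandWord)⁻¹ * (FreeGroup.of 0)⁻¹ := by
  simp only [nsRelator, FusionOne.discRelator, nsBandWord, mul_inv_rev, inv_inv, mul_assoc,
    mul_inv_cancel, mul_one]

/-- `discRelator w = x⁻¹ · r⁻¹ · x`. -/
theorem discRelator_eq_conj_inv_nsRelator :
    FusionOne.discRelator nsBandWord =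
      (FreeGroup.of 0)⁻¹ * nsRelator⁻¹ * ((FreeGroup.of 0)⁻¹)⁻¹ := by
  rw [nsRelator_eq_conj_inv_discRelator]
  group

/-- The two one-relator presentations have the same normal closure in `F₂`. -/
theorem normalClosure_nsRelator_eq :
    Subgroup.normalClosure ({nsRelator} : Set (FreeGroup (Fin 2))) =
      Subgroup.normalClosure ({FusionOne.discRelator nsBandWord} : Set (FreeGroup (Fin 2))) := by
  apply le_antisymm
  · apply Subgroup.normalClosure_le_normal
    intro g hg
    rw [Set.mem_singleton_iff] at hg
    subst hg
    have h : FusionOne.discRelator nsBandWord ∈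
        Subgroup.normalClosure ({FusionOne.discRelator nsBandWord} : Set (FreeGroup (Fin 2))) :=
      Subgroup.subset_normalClosure (Set.mem_singleton _)
    rw [SetLike.mem_coe, nsRelator_eq_conj_inv_discRelator]
    exact Subgroup.normalClosure_normal.conj_mem _ (inv_mem h) _
  · apply Subgroup.normalClosure_le_normal
    intro g hg
    rw [Set.mem_singleton_iff] at hg
    subst hg
    have h : nsRelator ∈ Subgroup.normalClosure ({nsRelator} : Set (FreeGroup (Fin 2))) :=
      Subgroup.subset_normalClosure (Set.mem_singleton _)
    rw [SetLike.mem_coe, discRelator_eq_conj_inv_nsRelator]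
    exact Subgroup.normalClosure_normal.conj_mem _ (inv_mem h) _

/-- `G_NS ≃* ⟨x₁, x₂ | x₁ = w x₂ w⁻¹⟩` for `w = y x y x⁻¹`: the Nash–Stipsicz group is a
fusion-number-one disc group. -/
def nsGroupMulEquivDiscGroup : NSGroup ≃* FusionOne.DiscGroup nsBandWord :=
  QuotientGroup.quotientMulEquivOfEq normalClosure_nsRelator_eq

/-- The isomorphism sends the generator `x` to `x₁` and `y` to `x₂`. -/
theorem nsGroupMulEquivDiscGroup_of (i : Fin 2) :
    nsGroupMulEquivDiscGroup (PresentedGroup.of i) = PresentedGroup.of i := rfl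

/-- The disc group `⟨x₁, x₂ | x₁ = w x₂ w⁻¹⟩`, `w = x₂ x₁ x₂ x₁⁻¹`, is not solvable. -/
theorem not_isSolvable_discGroup_nsBandWord : ¬ IsSolvable (FusionOne.DiscGroup nsBandWord) := by
  intro hs
  exact not_isSolvable
    (solvable_of_solvable_injective (G := NSGroup) (G' := FusionOne.DiscGroup nsBandWord)
      (f := nsGroupMulEquivDiscGroup.toMonoidHom) nsGroupMulEquivDiscGroup.injective)

end NashStipsicz
end Summit.SmoothPoincare4.SmoothPoincare4.Theorems
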